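import Summits.SmoothPoincare4.SmoothPoincare4.Theorems.ConvexBisectionAcyclicBisectionExistsSeamStraightenField
import Summits.SmoothPoincare4.SmoothPoincare4.Theorems.ConvexBisectionAcyclicBisectionExistsPageRotationFlow
import Mathlib.MeasureTheory.Integral.IntervalIntegral.FundThmCalculus
import HarnessLib

/-!
# The flow of the radial straightening field: extended pages are isotoped into flat pages
(wave 4, brick ST2 (flow part) of node T3c-2 `node_seam_transport` of stub
`stub_steinRealisation` = NF6, line `modp-braid-orbits` r11, crux
`ConvexBisection.AcyclicBisectionExists`, item stmt-SmoothPoincare4-10508; registered sub-goal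
`helper_strFlow_page`)

The straightening field `strField g L` of the prequel (`…SeamStraightenField.lean`: smooth,
supported in `{rho ≤ 2/5}`, `d rho(V) = 0`, `dw(V) = ν · w` with `ν = L · strGain · strMu ≥ 0`
real, `dx(V) = −κ x` with `κ = L · strGain · ‖w‖²`) is integrated:

* §1 invariants along an integral curve `γ` (`rho` is a first integral of the flow by
  `d rho(V) = 0` and `apply_flow_eq_of_fderiv_comp_eq_zero`): **`w (γ t) = exp(∫₀ᵗ ν) · w (γ 0)`** (`w_strFlowline_eq`, integrating factor + FTC), so the
  direction of `w` is preserved — every extended page `{w ∈ ℝ_{>0} c}` and the binding are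
  invariant — and `‖w‖` does not decrease in forward time; `‖x ∘ γ‖²` is non-increasing
  (`normSq_cx_strFlowline_antitone`), so the flat part `‖x‖² < 4` is forward invariant; and
  **FLATTENING** (`normSq_cx_strFlowline_one_lt_four`): for `L ≥ 1/m²`, a point of
  `{rho ≤ 3/10}` with `‖w‖ ≥ m` has `‖x‖² < 4` at time `1` (while `‖x‖² ≥ 4` the gain is `1`
  and `(‖x‖²)' = −2L‖w‖²‖x‖² ≤ −8`, but `‖x‖² < 6` at time `0`);
* §2 the global flow (`exists_strFlow`, compact support) and §3 the package `helper_strFlow_page`: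
  an `AmbientIsotopy (𝓡∂ 4) (Base g)` (`baseIsotopy` of `…PageRotationFlow.lean`) preserving
  `rho`, the direction of `w`, the binding and `{‖x‖² ≤ 3}` pointwise, every flat page forwards,
  and carrying, at time `1`, every point of the extended page `{rho = 1/4, w ∈ ℝ_{>0} c}` with
  `‖w‖ ≥ m` into the flat page `page g c`.

Everything is proved; no named facts, no `sorry`.  References: R. İ. Baykur, *Kähler
decomposition of 4-manifolds*, AGT 6 (2006), proof of Thm. 5.1 [Baykur2006]; M. W. Hirsch,
*Differential Topology* (1976), Ch. 8 §1 [HirschDT1976]; J. M. Lee, *Introduction to Smooth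
Manifolds* (2012), Thm. 9.16 [LeeSmoothManifolds2013].
-/

noncomputable section

set_option linter.dupNamespace false

open scoped Manifold ContDiff Topology ComplexConjugate
open Set Function Metric
open Literature.Topology.FourManifolds Literature.Topology.FourManifolds.LefschetzBase

namespace Summit.SmoothPoincare4.SmoothPoincare4.Theorems.AcyclicBisectionExists.ModpBraidOrbits

variable {g : ℕ} {L : ℝ}

/-! ## §1 Invariants along integral curves of the straightening field -/

section Curve

variable {γ : ℝ → EuclideanSpace ℝ (Fin 4)} (hγ : ∀ t, HasDerivAt γ (strField g L (γ t)) t)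
include hγ

/-- The page coordinate along an integral curve: `(w ∘ γ)' = ν · (w ∘ γ)` with the real rate
`ν = L · strGain · strMu`. [folklore] -/
theorem hasDerivAt_w_strFlowline (t : ℝ) :
    HasDerivAt (fun s => w g (γ s)) (((L * strGain g (γ t) * strMu (γ t) : ℝ) : ℂ) * w g (γ t)) t := by
  have h := (((contDiff_w g).differentiable (by simp)) (γ t)).hasFDerivAt.comp_hasDerivAt t (hγ t)
  rwa [fderiv_w_strField] at h

/-- The rate `ν ∘ γ` is continuous. [folklore] -/
theorem continuous_strRate : Continuous fun s => L * strGain g (γ s) * strMu (γ s) := by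
  have hc : Continuous γ := continuous_iff_continuousAt.2 fun t => (hγ t).continuousAt
  exact (continuous_const.mul (contDiff_strGain.continuous.comp hc)).mul
    (contDiff_strMu.continuous.comp hc)

/-- **The direction of `w` is preserved**: `w (γ t) = exp(∫₀ᵗ ν) · w (γ 0)` (integrating
factor `exp(−∫₀ᵗ ν)`, fundamental theorem of calculus). [folklore] -/
theorem w_strFlowline_eq (t : ℝ) :
    w g (γ t) = ((Real.exp (∫ s in (0 : ℝ)..t, L * strGain g (γ s) * strMu (γ s)) : ℝ) : ℂ) *
      w g (γ 0) := by
  set ν : ℝ → ℝ := fun s => L * strGain g (γ s) * strMu (γ s) with hν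
  have hνc : Continuous ν := continuous_strRate hγ
  -- the integrating factor `E s = exp (-∫₀ˢ ν)`
  have hI : ∀ s, HasDerivAt (fun u => ∫ x in (0 : ℝ)..u, ν x) (ν s) s := fun s =>
    (hνc.integral_hasStrictDerivAt 0 s).hasDerivAt
  have hE : ∀ s, HasDerivAt (fun u => Real.exp (-∫ x in (0 : ℝ)..u, ν x))
      (Real.exp (-∫ x in (0 : ℝ)..s, ν x) * -ν s) s := fun s => (hI s).neg.exp
  have hEc : ∀ s, HasDerivAt (fun u => ((Real.exp (-∫ x in (0 : ℝ)..u, ν x) : ℝ) : ℂ))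
      (((Real.exp (-∫ x in (0 : ℝ)..s, ν x) * -ν s : ℝ) : ℂ)) s := fun s => (hE s).ofReal_comp
  have hprod : ∀ s, HasDerivAt
      (fun u => ((Real.exp (-∫ x in (0 : ℝ)..u, ν x) : ℝ) : ℂ) * w g (γ u)) 0 s := by
    intro s
    refine ((hEc s).mul (hasDerivAt_w_strFlowline hγ s)).congr_deriv ?_
    simp only [hν]
    push_cast
    ring
  have hconst := is_const_of_deriv_eq_zero (fun s => (hprod s).differentiableAt)
    (fun s => (hprod s).deriv) t 0
  simp only [intervalIntegral.integral_same, neg_zero, Real.exp_zero, Complex.ofReal_one,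
    one_mul] at hconst
  calc w g (γ t) = ((Real.exp (∫ s in (0 : ℝ)..t, ν s) : ℝ) : ℂ) *
        (((Real.exp (-∫ x in (0 : ℝ)..t, ν x) : ℝ) : ℂ) * w g (γ t)) := by
          rw [← mul_assoc, ← Complex.ofReal_mul, ← Real.exp_add, add_neg_cancel, Real.exp_zero,
            Complex.ofReal_one, one_mul]
    _ = ((Real.exp (∫ s in (0 : ℝ)..t, ν s) : ℝ) : ℂ) * w g (γ 0) := by rw [hconst]

/-- The direction of `w` is preserved: `w (γ t)` is a positive real multiple of `w (γ 0)`.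
[folklore] -/
theorem exists_w_strFlowline_eq_mul (t : ℝ) : ∃ r : ℝ, 0 < r ∧ w g (γ t) = (r : ℂ) * w g (γ 0) :=
  ⟨_, Real.exp_pos _, w_strFlowline_eq hγ t⟩

/-- **`‖w‖` does not decrease in forward time** (for `L ≥ 0` the rate is non-negative).
[folklore] -/
theorem norm_w_strFlowline_le (hL : 0 ≤ L) {t : ℝ} (ht : 0 ≤ t) : ‖w g (γ 0)‖ ≤ ‖w g (γ t)‖ := by
  rw [w_strFlowline_eq hγ t, norm_mul, Complex.norm_real, Real.norm_eq_abs, abs_of_pos (Real.exp_pos _)]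
  have h1 : 1 ≤ Real.exp (∫ s in (0 : ℝ)..t, L * strGain g (γ s) * strMu (γ s)) := by
    refine Real.one_le_exp (intervalIntegral.integral_nonneg ht fun s _ => ?_)
    exact mul_nonneg (mul_nonneg hL (strGain_nonneg _)) (strMu_nonneg _)
  nlinarith [norm_nonneg (w g (γ 0))]

/-- The coordinate `x` along an integral curve. [folklore] -/
theorem hasDerivAt_cx_strFlowline (t : ℝ) :
    HasDerivAt (fun s => cx (γ s)) (cx (strField g L (γ t))) t := by
  have h := cxL.hasFDerivAt.comp_hasDerivAt t (hγ t)
  simpa only [Function.comp_def, cxL_apply] using h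

/-- `(‖x ∘ γ‖²)' = −2 κ ‖x‖²` with `κ = L · strGain · ‖w‖²`. [folklore] -/
theorem hasDerivAt_normSq_cx_strFlowline (t : ℝ) :
    HasDerivAt (fun s => ‖cx (γ s)‖ ^ 2)
      (-(2 * (L * strGain g (γ t) * ‖w g (γ t)‖ ^ 2) * ‖cx (γ t)‖ ^ 2)) t := by
  refine (hasDerivAt_norm_sq_comp (hasDerivAt_cx_strFlowline hγ t)).congr_deriv ?_
  rw [cx_strField]
  have e : conj (cx (γ t)) * -(((L * strGain g (γ t) * ‖w g (γ t)‖ ^ 2 : ℝ) : ℂ) * cx (γ t)) =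
      -(((L * strGain g (γ t) * ‖w g (γ t)‖ ^ 2 : ℝ) : ℂ) * (conj (cx (γ t)) * cx (γ t))) := by ring
  rw [e, Complex.neg_re, Complex.re_ofReal_mul, re_conj_mul_self]
  ring

/-- **`‖x‖²` is non-increasing along forward integral curves** (`L ≥ 0`): the flat part
`‖x‖² < 4` carrying the pages is forward invariant. [folklore] -/
theorem normSq_cx_strFlowline_antitone (hL : 0 ≤ L) : Antitone fun s => ‖cx (γ s)‖ ^ 2 := by
  refine antitone_of_deriv_nonpos (fun s => (hasDerivAt_normSq_cx_strFlowline hγ s).differentiableAt)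
    fun s => ?_
  rw [(hasDerivAt_normSq_cx_strFlowline hγ s).deriv, neg_nonpos]
  have h1 : 0 ≤ L * strGain g (γ s) * ‖w g (γ s)‖ ^ 2 :=
    mul_nonneg (mul_nonneg hL (strGain_nonneg _)) (sq_nonneg _)
  positivity

/-- **Flattening**: for `L ≥ 1/m²`, an integral curve inside `{rho ≤ 3/10}` (the flow preserves
`rho`: `d rho (strField) = 0`, `apply_flow_eq_of_fderiv_comp_eq_zero`) with `‖w‖ ≥ m` at time `0`
has `‖x‖² < 4` at time `1`. [folklore] -/
theorem normSq_cx_strFlowline_one_lt_four {m : ℝ} (hm : 0 < m) (hL : 1 / m ^ 2 ≤ L)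
    (hρ : ∀ s, rho g (γ s) ≤ 3 / 10) (hw : m ≤ ‖w g (γ 0)‖) : ‖cx (γ 1)‖ ^ 2 < 4 := by
  have hL0 : 0 ≤ L := le_trans (by positivity) hL
  have hLm : 1 ≤ L * m ^ 2 := by
    have h := mul_le_mul_of_nonneg_right hL (sq_nonneg m)
    rwa [one_div, inv_mul_cancel₀ (pow_ne_zero 2 hm.ne')] at h
  set f : ℝ → ℝ := fun s => ‖cx (γ s)‖ ^ 2 with hf
  have hanti : Antitone f := normSq_cx_strFlowline_antitone hγ hL0
  -- at time `0`, `‖x‖² < 6`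
  have h6 : f 0 < 6 := by
    by_contra h
    have h' : (1 / 2 : ℝ) ≤ eta (‖cx (γ 0)‖ ^ 2) := half_le_eta_six.trans (eta_monotone (not_lt.1 h))
    have : eta (‖cx (γ 0)‖ ^ 2) ≤ rho g (γ 0) := by unfold rho; nlinarith [sq_nonneg ‖w g (γ 0)‖]
    linarith [hρ 0]
  by_contra h4
  rw [not_lt] at h4
  -- on `[0, 1]` the derivative is `≤ -8`
  have hderiv : ∀ s ∈ interior (Icc (0 : ℝ) 1), deriv f s ≤ -8 := by
    intro s hs
    rw [interior_Icc] at hs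
    have hs4 : 4 ≤ f s := h4.trans (hanti hs.2.le)
    have hgain : strGain g (γ s) = 1 := strGain_eq_one (hρ s) (by show 7 / 2 ≤ f s; linarith)
    have hws : m ≤ ‖w g (γ s)‖ := hw.trans (norm_w_strFlowline_le hγ hL0 hs.1.le)
    have hws2 : m ^ 2 ≤ ‖w g (γ s)‖ ^ 2 := pow_le_pow_left₀ hm.le hws 2
    rw [(hasDerivAt_normSq_cx_strFlowline hγ s).deriv, hgain, mul_one]
    have h1 : 1 ≤ L * ‖w g (γ s)‖ ^ 2 := hLm.trans (mul_le_mul_of_nonneg_left hws2 hL0)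
    have h2 : (4 : ℝ) ≤ ‖cx (γ s)‖ ^ 2 := hs4
    nlinarith
  have hcont : ContinuousOn f (Icc 0 1) := fun s _ =>
    (hasDerivAt_normSq_cx_strFlowline hγ s).continuousAt.continuousWithinAt
  have hdiff : DifferentiableOn ℝ f (interior (Icc 0 1)) := fun s _ =>
    (hasDerivAt_normSq_cx_strFlowline hγ s).differentiableAt.differentiableWithinAt
  have hmv := (convex_Icc (0 : ℝ) 1).image_sub_le_mul_sub_of_deriv_le hcont hdiff hderiv 0
    (left_mem_Icc.2 zero_le_one) 1 (right_mem_Icc.2 zero_le_one) zero_le_one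
  have h0 : (0 : ℝ) ≤ f 1 := sq_nonneg _
  linarith

end Curve

/-! ## §2 The global flow of the straightening field -/

/-- **The straightening field has a smooth complete flow** (compact support; zeros of the field
are fixed points). [cite: LeeSmoothManifolds2013, Thm. 9.16] -/
theorem exists_strFlow (g : ℕ) (L : ℝ) :
    ∃ θ : ℝ × EuclideanSpace ℝ (Fin 4) → EuclideanSpace ℝ (Fin 4), ContDiff ℝ ∞ θ ∧
      (∀ x, θ (0, x) = x) ∧ (∀ t s x, θ (t, θ (s, x)) = θ (t + s, x)) ∧
      (∀ x t, HasDerivAt (fun t => θ (t, x)) (strField g L (θ (t, x))) t) ∧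
      (∀ x, strField g L x = 0 → ∀ t, θ (t, x) = x) :=
  Literature.Geometry.Manifold.exists_contDiff_globalFlow (contDiff_strField g L)
    (isCompact_rho_le_two_fifths g) fun _ hx => strField_eq_zero_of_not_mem hx

/-! ## §3 The registered sub-goal: the straightening isotopy of the base -/

/-- **(ST2) The radial straightening isotopy of the Lefschetz base** (registered sub-goal
`helper_strFlow_page` of NF6, node T3c-2 `node_seam_transport`): for every margin `m > 0` there
is an ambient isotopy `R` of `Base g` (the flow of `strField g (1/m²)` restricted to the base),
the restriction of a smooth flow `θ` of `ℝ⁴`, which preserves every level of `rho` (so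
`∂ Base g`), preserves the DIRECTION of the page coordinate `w` (`w (θ_t x) = r · w x`, `r > 0`:
every extended page `{w ∈ ℝ_{>0} c}` and the binding `{w = 0}` are invariant), does not decrease
`‖w‖` nor increase `‖x‖²` in forward time (so flat pages stay flat: `R_t (page g c) ⊆ page g c`
for `t ≥ 0`), fixes the binding and the deep flat part `{‖x‖² ≤ 3}` pointwise, and FLATTENS at
time `1`: every point of `{rho ≤ 3/10}` with `‖w‖ ≥ m` has `‖x‖² < 4` at time `1`; in particular
every point of the extended page `{rho = 1/4, w ∈ ℝ_{>0} c}` (`‖c‖ = 1`) with `‖w‖ ≥ m` is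
carried into the flat page `page g c`.  This is the fibred isotopy of `∂ Base g` which reads the
seam-transported vanishing cycles of a fibred model in the flat pages (Baykur 2006, proof of
Thm. 5.1, the identification of the boundary open books). [cite: Baykur2006, Thm. 5.1 (proof, p. 13)] -/
theorem helper_strFlow_page : ∀ (g : ℕ) (m : ℝ), 0 < m → ∃ (R : Literature.Topology.FourManifolds.AmbientIsotopy (𝓡∂ 4) (Literature.Topology.FourManifolds.LefschetzBase.Base g)) (θ : ℝ × EuclideanSpace ℝ (Fin 4) → EuclideanSpace ℝ (Fin 4)), ContDiff ℝ ∞ θ ∧ (∀ x, θ (0, x) = x) ∧ (∀ t s x, θ (t, θ (s, x)) = θ (t + s, x)) ∧ (∀ (t : ℝ) (x : Literature.Topology.FourManifolds.LefschetzBase.Base g), (R.toFun t x).1 = θ (t, x.1)) ∧ (∀ t x, Literature.Topology.FourManifolds.LefschetzBase.rho g (θ (t, x)) = Literature.Topology.FourManifolds.LefschetzBase.rho g x) ∧ (∀ t x, ∃ r : ℝ, 0 < r ∧ Literature.Topology.FourManifolds.LefschetzBase.w g (θ (t, x)) = (r : ℂ) * Literature.Topology.FourManifolds.LefschetzBase.w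 g x) ∧ (∀ t x, 0 ≤ t → ‖Literature.Topology.FourManifolds.LefschetzBase.w g x‖ ≤ ‖Literature.Topology.FourManifolds.LefschetzBase.w g (θ (t, x))‖) ∧ (∀ t x, 0 ≤ t → ‖Literature.Topology.FourManifolds.LefschetzBase.cx (θ (t, x))‖ ^ 2 ≤ ‖Literature.Topology.FourManifolds.LefschetzBase.cx x‖ ^ 2) ∧ (∀ x, Literature.Topology.FourManifolds.LefschetzBase.w g x = 0 → ∀ t, θ (t, x) = x) ∧ (∀ x, ‖Literature.Topology.FourManifolds.LefschetzBase.cx x‖ ^ 2 ≤ 3 → ∀ t, θ (t, x) = x) ∧ (∀ x, Literature.Topology.FourManifolds.LefschetzBase.rho g x ≤ 3 / 10 → m ≤ ‖Literature.Topology.FourManifolds.LefschetzBase.w g x‖ → ‖Literature.Topology.FourManifolds.LefschetzBase.cx (θ (1, x))‖ ^ 2 < 4) ∧ (∀ (t : ℝ) (x : Literature.Topology.FourManifolds.LefschetzBase.Base g) (c : ℂ), 0 ≤ t → x ∈ Literature.Topology.FourManifolds.LefschetzBase.page g c → R.toFun t x ∈ Literature.Topology.FourManifolds.LefschetzBase.page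 g c) ∧ (∀ (x : Literature.Topology.FourManifolds.LefschetzBase.Base g) (c : ℂ), ‖c‖ = 1 → Literature.Topology.FourManifolds.LefschetzBase.rho g x.1 = 1 / 4 → m ≤ ‖Literature.Topology.FourManifolds.LefschetzBase.w g x.1‖ → (∃ r : ℝ, 0 < r ∧ Literature.Topology.FourManifolds.LefschetzBase.w g x.1 = (r : ℂ) * c) → R.toFun 1 x ∈ Literature.Topology.FourManifolds.LefschetzBase.page g c) := by
  intro g m hm
  obtain ⟨θ, hθ, h0, hadd, hder, hfix⟩ := exists_strFlow g (1 / m ^ 2)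
  have hL0 : (0 : ℝ) ≤ 1 / m ^ 2 := by positivity
  have hrho : ∀ t x, rho g (θ (t, x)) = rho g x := fun t x =>
    Literature.Geometry.Manifold.apply_flow_eq_of_fderiv_comp_eq_zero h0 hder
      ((contDiff_rho g).differentiable (by simp)) fderiv_rho_strField t x
  have hdir : ∀ t x, ∃ r : ℝ, 0 < r ∧ w g (θ (t, x)) = (r : ℂ) * w g x := fun t x => by
    have h := exists_w_strFlowline_eq_mul (hder x) t
    rwa [h0] at h
  have hwmono : ∀ t x, 0 ≤ t → ‖w g x‖ ≤ ‖w g (θ (t, x))‖ := fun t x ht => by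
    have h := norm_w_strFlowline_le (hder x) hL0 ht
    rwa [h0] at h
  have hxmono : ∀ t x, 0 ≤ t → ‖cx (θ (t, x))‖ ^ 2 ≤ ‖cx x‖ ^ 2 := fun t x ht => by
    have h := normSq_cx_strFlowline_antitone (hder x) hL0 ht
    simp only [h0] at h
    exact h
  have hflat : ∀ x, rho g x ≤ 3 / 10 → m ≤ ‖w g x‖ → ‖cx (θ (1, x))‖ ^ 2 < 4 := fun x hρ hw =>
    normSq_cx_strFlowline_one_lt_four (hder x) hm le_rfl (fun s => by rw [hrho]; exact hρ) (by rwa [h0])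
  -- flat pages are forward invariant
  have hpage : ∀ (t : ℝ) (x : Base g) (c : ℂ), 0 ≤ t → x ∈ page g c →
      (baseIsotopy hrho h0 hadd hθ).toFun t x ∈ page g c := by
    intro t x c ht hx
    obtain ⟨hx4, hxw⟩ := hx
    have hx4' : ‖cx (θ (t, x.1))‖ ^ 2 < 4 := (hxmono t x.1 ht).trans_lt hx4
    refine ⟨hx4', ?_⟩
    show w g (θ (t, x.1)) = c / 2
    obtain ⟨r, hr, hrw⟩ := hdir t x.1
    have hρ := hrho t x.1
    rw [rho, rho, eta_of_le hx4'.le, eta_of_le hx4.le, add_zero, add_zero, hrw, norm_mul,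
      Complex.norm_real, Real.norm_eq_abs, abs_of_pos hr, mul_pow] at hρ
    by_cases hw0 : w g x.1 = 0
    · rw [hrw, hw0, mul_zero]
      rw [← hxw, hw0]
    · have hn : ‖w g x.1‖ ^ 2 ≠ 0 := pow_ne_zero 2 (norm_ne_zero_iff.2 hw0)
      have hr1 : r ^ 2 = 1 := by
        have := mul_right_cancel₀ hn (hρ.trans (one_mul _).symm)
        exact this
      have hr1' : r = 1 := by nlinarith
      rw [hrw, hr1', Complex.ofReal_one, one_mul, hxw]
  -- extended pages are flattened at time `1`
  have hext : ∀ (x : Base g) (c : ℂ), ‖c‖ = 1 → rho g x.1 = 1 / 4 → m ≤ ‖w g x.1‖ →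
      (∃ r : ℝ, 0 < r ∧ w g x.1 = (r : ℂ) * c) → (baseIsotopy hrho h0 hadd hθ).toFun 1 x ∈ page g c := by
    intro x c hc hρ hw hray
    obtain ⟨r, hr, hrc⟩ := hray
    have hx4 : ‖cx (θ (1, x.1))‖ ^ 2 < 4 := hflat x.1 (by rw [hρ]; norm_num) hw
    refine ⟨hx4, ?_⟩
    show w g (θ (1, x.1)) = c / 2
    obtain ⟨r', hr', hrw⟩ := hdir 1 x.1
    have hρ1 := hrho 1 x.1
    rw [hρ, rho, eta_of_le hx4.le, add_zero, hrw, hrc, norm_mul, norm_mul, Complex.norm_real,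
      Complex.norm_real, Real.norm_eq_abs, Real.norm_eq_abs, abs_of_pos hr, abs_of_pos hr', hc,
      mul_one] at hρ1
    have hpos : 0 < r' * r := mul_pos hr' hr
    have hhalf : r' * r = 1 / 2 := by nlinarith
    rw [hrw, hrc, ← mul_assoc, ← Complex.ofReal_mul, hhalf]
    push_cast
    ring
  refine ⟨baseIsotopy hrho h0 hadd hθ, θ, hθ, h0, hadd, fun t x => rfl, hrho, hdir, hwmono, hxmono,
    fun x hx => hfix x (strField_eq_zero_of_w_eq_zero hx),
    fun x hx => hfix x (strField_eq_zero_of_cx_le hx), hflat, hpage, hext⟩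

end Summit.SmoothPoincare4.SmoothPoincare4.Theorems.AcyclicBisectionExists.ModpBraidOrbits

end
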